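import Literature.NumberTheory.LFunctions.WeilBochnerRepresentationRH
import Literature.NumberTheory.LFunctions.WeilBochnerRepresentationGRH
import Literature.NumberTheory.LFunctions.WeilZeroSum
import Literature.NumberTheory.LFunctions.ExplicitFormulaPsiChar
import HarnessLib

/-!
# rh-explicit (venture WeilGRH): THE ZERO-HEIGHT MEASURES ARE ℕ-VALUED ON BOUNDED SETS — `ν_ζ(S) ∈ ℕ`,
  `ν_χ(S) ∈ ℕ` for every bounded Borel `S` (unconditionally), so that under RH / `GRH(χ)` they are
  ℕ-valued Weil measures of every rung

Cell `rh-explicit`, WEIL TRACK (structure seat weil-3, gen16).  The rigidity theorems of the track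
(`GramDiagonalExclusion`, `GramFormExclusion`, `WeilMeasureEmptyLowHeights`, `TwistedGramFormExclusion`, the
Christoffel certificate files) are stated for positive measures `μ` representing Weil's form on the tests of a
window `[-a, a]` that give every bounded measurable set a natural-number mass
(`∀ S, MeasurableSet S → IsBounded S → ∃ k : ℕ, μ.real S = k`).  This file discharges that hypothesis for the
two arithmetic measures of the tree, with NO hypothesis on the zeros:

* `zetaZeroHeightMeasure_natValued`: `ν_ζ = Σ_ρ m(ρ) δ_{Im ρ}` (`WeilBochnerRepresentationRH`) is ℕ-valued on
  bounded Borel sets — finitely many non-trivial zeros have ordinate in a bounded set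
  (`IsCompact.inter_riemannZetaZeros_finite`), each with a natural multiplicity;
* `charZeroHeightMeasure_natValued`: the same for `ν_χ = Σ_ρ m_χ(ρ) δ_{Im ρ}` (`χ ≠ 1`;
  `ExplicitPsiChar.lfunctionZeroBox_finite`);
* `represents_zetaZeroHeightMeasure_of_riemannHypothesis`, `represents_charZeroHeightMeasure_of_grh`: under RH
  (resp. `GRH(χ)`, `χ` primitive mod `q ≠ 1`) they represent Weil's form (resp. `Q_χ`) on the tests of EVERY
  window, in the exact hypothesis shape of the rigidity files — so every «ℕ-valued Weil measure» theorem of the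
  track specialises to the zeros of `ζ` / `L(s, χ)` under RH / GRH by one `exact`.

No definitions, no named facts, standard axioms; nothing here bears on the truth of RH.
-/

set_option autoImplicit false

noncomputable section

open Complex Set MeasureTheory
open scoped Real ENNReal

namespace Summit.Ventures.WeilGRH

open Literature.NumberTheory.LFunctions
open Literature.NumberTheory.LFunctions.ZetaZeros (riemannZetaNontrivialZeros)
open Literature.NumberTheory.LFunctions.ExplicitPsiChar
open Literature.NumberTheory.LFunctions.WeilBochner (zetaZeroHeightMeasure charZeroHeightMeasure
  weilQuadratic_eq_integral_of_riemannHypothesis weilQuadraticChar_eq_integral_of_riemannHypothesis)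

/-! ## A sum of naturally weighted Dirac masses is ℕ-valued where finitely many of them sit -/

/-- If only finitely many indices `i` have `f i ∈ S`, the measure `Σ_i n_i δ_{f i}` (`n_i ∈ ℕ`) gives `S` the
natural mass `Σ_{f i ∈ S} n_i`. -/
theorem exists_nat_sum_smul_dirac_real_eq {ι : Type*} (n : ι → ℕ) (f : ι → ℝ) {S : Set ℝ}
    (hS : MeasurableSet S) (hfin : {i | f i ∈ S}.Finite) :
    ∃ k : ℕ, (Measure.sum fun i ↦ (n i : ℝ≥0∞) • Measure.dirac (f i)).real S = k := by
  classical
  refine ⟨∑ i ∈ hfin.toFinset, n i, ?_⟩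
  rw [measureReal_def, Measure.sum_apply _ hS]
  simp only [Measure.smul_apply, smul_eq_mul, Measure.dirac_apply' _ hS]
  have hterm : ∀ i, (n i : ℝ≥0∞) * S.indicator 1 (f i) = if f i ∈ S then (n i : ℝ≥0∞) else 0 := by
    intro i
    by_cases h : f i ∈ S
    · rw [indicator_of_mem h, Pi.one_apply, mul_one, if_pos h]
    · rw [indicator_of_notMem h, mul_zero, if_neg h]
  simp_rw [hterm]
  rw [tsum_eq_sum (s := hfin.toFinset) (f := fun i ↦ if f i ∈ S then (n i : ℝ≥0∞) else 0) ?_]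
  · rw [Finset.sum_congr rfl ?_, ← Nat.cast_sum, ENNReal.toReal_natCast]
    intro i hi
    exact if_pos (hfin.mem_toFinset.1 hi)
  · intro i hi
    exact if_neg fun h ↦ hi (hfin.mem_toFinset.2 h)

/-! ## `ν_ζ` -/

/-- The non-trivial zeros of `ζ` with ordinate of absolute value `≤ M` form a finite set. -/
theorem riemannZetaNontrivialZeros_abs_im_le_finite (M : ℝ) :
    {ρ : ℂ | ρ ∈ riemannZetaNontrivialZeros ∧ |ρ.im| ≤ M}.Finite := by
  refine ((isCompact_Icc (a := (0 : ℝ)) (b := 1)).reProdIm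
    (isCompact_Icc (a := -M) (b := M))).inter_riemannZetaZeros_finite.subset ?_
  rintro ρ ⟨hρ, hM⟩
  obtain ⟨h0, h1, h2⟩ := ZetaZeros.riemannZetaNontrivialZeros.mem_iff'.1 hρ
  exact ⟨Complex.mem_reProdIm.2 ⟨⟨h1.le, h2.le⟩, abs_le.1 hM⟩, h0⟩

/-- ★ **`ν_ζ` IS ℕ-VALUED ON BOUNDED BOREL SETS** (unconditionally): for every bounded measurable `S ⊆ ℝ`
there is `k : ℕ` with `ν_ζ(S) = k` — the number of non-trivial zeros of `ζ` with ordinate in `S`, counted with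
multiplicity. -/
theorem zetaZeroHeightMeasure_natValued :
    ∀ S : Set ℝ, MeasurableSet S → Bornology.IsBounded S → ∃ k : ℕ, zetaZeroHeightMeasure.real S = k := by
  intro S hS hb
  obtain ⟨M, hM⟩ := isBounded_iff_forall_norm_le.1 hb
  rw [zetaZeroHeightMeasure]
  refine exists_nat_sum_smul_dirac_real_eq (fun ρ : riemannZetaNontrivialZeros ↦ (riemannZetaZeroOrder (ρ : ℂ)).toNat)
    (fun ρ ↦ (ρ : ℂ).im) hS ?_
  refine ((riemannZetaNontrivialZeros_abs_im_le_finite M).preimage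
    (f := (Subtype.val : riemannZetaNontrivialZeros → ℂ)) Subtype.val_injective.injOn).subset ?_
  intro ρ hρ
  have h := hM _ hρ
  rw [Real.norm_eq_abs] at h
  exact ⟨ρ.2, h⟩

/-- **Under RH, `ν_ζ` represents Weil's form on the tests of every window** — the hypothesis shape of the
rigidity files (`GramFormExclusion`, `ChristoffelCertificateCheck`, …); with `zetaZeroHeightMeasure_natValued` every
«ℕ-valued Weil measure of the rung» theorem applies to the zeros of `ζ`. -/
theorem represents_zetaZeroHeightMeasure_of_riemannHypothesis (hRH : RiemannHypothesis) (a : ℝ) :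
    ∀ g : ℝ → ℂ, IsWeilTest g → tsupport g ⊆ Icc (-a) a →
      Integrable (fun t : ℝ ↦ ‖weilMellin g (1 / 2 + t * I)‖ ^ 2) zetaZeroHeightMeasure ∧
        weilQuadratic g = ((∫ t, ‖weilMellin g (1 / 2 + t * I)‖ ^ 2 ∂zetaZeroHeightMeasure : ℝ) : ℂ) :=
  fun _ hg _ ↦ weilQuadratic_eq_integral_of_riemannHypothesis hRH hg

/-! ## `ν_χ` -/

section Char

variable {q : ℕ} [NeZero q] {χ : DirichletCharacter ℂ q}

/-- The non-trivial zeros of `L(s, χ)` (`χ ≠ 1`) with ordinate of absolute value `≤ M` form a finite set. -/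
theorem charNontrivialZeros_abs_im_le_finite (hχ : χ ≠ 1) (M : ℝ) :
    {ρ : ℂ | ρ ∈ charNontrivialZeros χ ∧ |ρ.im| ≤ M}.Finite := by
  refine (lfunctionZeroBox_finite hχ M).subset ?_
  rintro ρ ⟨⟨h0, h1, h2⟩, hM⟩
  exact ⟨h0, h1, h2, hM⟩

/-- ★ **`ν_χ` IS ℕ-VALUED ON BOUNDED BOREL SETS** (`χ ≠ 1`, unconditionally): for every bounded measurable
`S ⊆ ℝ` there is `k : ℕ` with `ν_χ(S) = k`. -/
theorem charZeroHeightMeasure_natValued (hχ : χ ≠ 1) :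
    ∀ S : Set ℝ, MeasurableSet S → Bornology.IsBounded S →
      ∃ k : ℕ, (charZeroHeightMeasure χ).real S = k := by
  intro S hS hb
  obtain ⟨M, hM⟩ := isBounded_iff_forall_norm_le.1 hb
  rw [charZeroHeightMeasure]
  refine exists_nat_sum_smul_dirac_real_eq (fun ρ : charNontrivialZeros χ ↦ DirichletDisc.zeroOrder χ (ρ : ℂ))
    (fun ρ ↦ (ρ : ℂ).im) hS ?_
  refine ((charNontrivialZeros_abs_im_le_finite hχ M).preimage
    (f := (Subtype.val : charNontrivialZeros χ → ℂ)) Subtype.val_injective.injOn).subset ?_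
  intro ρ hρ
  have h := hM _ hρ
  rw [Real.norm_eq_abs] at h
  exact ⟨ρ.2, h⟩

/-- **Under `GRH(χ)` (`χ` primitive mod `q ≠ 1`), `ν_χ` represents `Q_χ` on the tests of every window** — the
hypothesis shape of `TwistedGramAtoms` / `TwistedGramFormExclusion`; with `charZeroHeightMeasure_natValued` every
«ℕ-valued representing measure» theorem of the GRH arm applies to the zeros of `L(s, χ)`. -/
theorem represents_charZeroHeightMeasure_of_grh (hq : q ≠ 1) (hprim : χ.IsPrimitive)
    (hGRH : χ.RiemannHypothesis) (a : ℝ) :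
    ∀ g : ℝ → ℂ, IsWeilTest g → tsupport g ⊆ Icc (-a) a →
      Integrable (fun t : ℝ ↦ ‖weilMellin g (1 / 2 + t * I)‖ ^ 2) (charZeroHeightMeasure χ) ∧
        weilQuadraticChar χ g =
          ((∫ t, ‖weilMellin g (1 / 2 + t * I)‖ ^ 2 ∂charZeroHeightMeasure χ : ℝ) : ℂ) :=
  fun _ hg _ ↦ weilQuadraticChar_eq_integral_of_riemannHypothesis hq hprim hGRH hg

end Char

end Summit.Ventures.WeilGRH

end
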